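import Summits.AtomisticToContinuum.HydrodynamicLimit.Theorems.CollisionIsometryCLTAdaptedWeightCLTTLPastDampingHorizon
import Summits.AtomisticToContinuum.HydrodynamicLimit.Theorems.CollisionIsometryCLTAdaptedWeightCLTTLPastDampingInput

/-!
# Stub `stub_pastDamping` of the line `contact-source-duhamel` (crux `CollisionIsometryCLT.AdaptedWeightCLT`,
stmt-AtomisticToContinuum-14868, the rev-12 time-local crux; `--supports`, registered signature, v2 =
the re-cut with the collision-count input `FewStepsOn` of `…TLPastDampingInput.lean`)

PAST DAMPING ON A HORIZON. For nice profiles, `0 < σ < 1/2` and a flow family `Φ`: column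
depolarisation in mean along the line window (`CDAlongAt`) and, at a horizon `t > 0`, velocity tails
(`TailsOn … t`) and few fold steps (`FewStepsOn … t`) imply `PastSmallOn … t`: for every admissible
kernel family and `δ > 0`, `P_N(∫₀ᵗ ∫ₓ Σ_tests PAST² > δ) → 0`.

Proof (probability layer over the pathwise horizon bound `PastDamping.horizon_bound`):
1. From `TailsOn` take `λ > 0`, `Cexp`. Choose the velocity cut-off `V ≥ 1` so large that the FAST
   part `κ₀ · 13 (4!/(λV)⁴ + 6!/(λV)⁶) Cexp < δ/4` (it tends to `0` as `V → ∞`), then the few-steps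
   rate `δ'` so small that the HAND-OVER part `κ₀ · 6(V⁴+V⁶) · 2√3|B₁| C σ · δ' ≤ δ/4`
   (`lipK ε_N (N+1)^{19/15} ≤ 2√3|B₁| C σ (N+1)`), and let `N` be large: the radii are small and the
   FLIGHT part `κ₀ · 6(V⁴+V⁶)(lipK Δℓ_N) √(Cexp/(λt)) t < δ/4` (`lipK Δℓ_N → 0`).
2. At such `N`, a datum `z` with `∫₀ᵗ∫ₓ PastSq > δ` is bad (`z ∉ good`), or in the tails event, or in the
   few-steps event, or has `κ₀ (V⁴+V⁶) ∫₀ᵗ cdWin ds ≥ δ/4` — else the horizon bound gives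
   `∫₀ᵗ∫ₓ PastSq < δ`. The first three events have probability `0`, `o(1)`, `o(1)`.
3. MARKOV for the last: through the jointly measurable modification `cdWinMod` of the window
   functional (equal to it on the good set), `P_N(ofReal(δ/4) ≤ ofReal(κ₀(V⁴+V⁶)) · ∫₀ᵗ cdWinMod)`
   `≤ ofReal(κ₀(V⁴+V⁶)) (∫₀ᵗ E_N[cdWinMod(s)] ds)/ofReal(δ/4)` (Tonelli), and the horizon integral of
   the means tends to `0` by `CDAlongAt` and dominated convergence in `s`
   (`PastDamping.tendsto_lintegral_cdMean`).
-/

namespace Summit.AtomisticToContinuum.HydrodynamicLimit.Theorems.ContactSourceDuhamel.TimeLocal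
namespace PastDamping

open scoped BigOperators Topology Classical MeasureTheory ENNReal InnerProductSpace
open Filter Set MeasureTheory
open Literature.Analysis.FluidPDE
open Literature.MathematicalPhysics.KineticTheory (hsDiameter hsDiameter_pos localGibbsLaw
  localGibbsLaw_absolutelyContinuous)

noncomputable section

variable {σ : ℝ}

/-- The cut-off constant tends to `0` as the cut-off grows (`λ > 0`). -/
theorem tendsto_cut46 {lam : ℝ} (hlam : 0 < lam) : Tendsto (fun V : ℝ => cut46 lam V) atTop (𝓝 0) := by
  have hx : Tendsto (fun V : ℝ => lam * V) atTop atTop := Tendsto.const_mul_atTop hlam tendsto_id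
  have h4 : Tendsto (fun V : ℝ => ((4 : ℕ).factorial : ℝ) / (lam * V) ^ 4) atTop (𝓝 0) :=
    tendsto_const_nhds.div_atTop ((tendsto_pow_atTop (by norm_num)).comp hx)
  have h6 : Tendsto (fun V : ℝ => ((6 : ℕ).factorial : ℝ) / (lam * V) ^ 6) atTop (𝓝 0) :=
    tendsto_const_nhds.div_atTop ((tendsto_pow_atTop (by norm_num)).comp hx)
  simpa [cut46] using h4.add h6

/-- The horizon integral of the window functional, as a lower integral of the modified version. -/
theorem ofReal_integral_cdSum_eq (hσ : 0 < σ) (hσ2 : σ < 2⁻¹) {N : ℕ} (Φ : Flow σ N) {z : Cfg N}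
    (hz : z ∈ Φ.good) (t : ℝ) :
    ENNReal.ofReal (∫ s in Icc 0 t, cdSum σ N (winStart σ N Φ s z) (winLen N s)) =
      ∫⁻ s in Icc 0 t, ENNReal.ofReal (cdWinMod σ N Φ (s, z)) := by
  have hG := FlowDict.regular_hsDiameter hσ.le hσ2 N
  have heq : (fun s => cdSum σ N (winStart σ N Φ s z) (winLen N s)) = fun s => cdWinMod σ N Φ (s, z) :=
    funext fun s => (cdWinMod_eq_of_mem Φ hz s).symm
  rw [heq]
  have hm : Measurable fun s => cdWinMod σ N Φ (s, z) :=
    (measurable_cdWinMod hG Φ).comp (measurable_id.prodMk measurable_const)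
  have hI : IntegrableOn (fun s => cdWinMod σ N Φ (s, z)) (Icc 0 t) := by
    refine IntegrableOn.of_bound measure_Icc_lt_top hm.aestronglyMeasurable.restrict 84 (ae_of_all _ fun s => ?_)
    rw [Real.norm_eq_abs, abs_of_nonneg (cdWinMod_mem Φ _).1]
    exact (cdWinMod_mem Φ _).2
  exact ofReal_integral_eq_lintegral_ofReal hI (ae_of_all _ fun s => (cdWinMod_mem Φ _).1)

/-- **PAST DAMPING ON A HORIZON** (`stub_pastDamping` of the line `contact-source-duhamel`, registered
signature, v2). See the module docstring. -/
theorem stub_pastDamping : ∀ (a₀ θ₀ : T3 → ℝ) (u₀ : T3 → V3), NiceProfiles a₀ θ₀ u₀ → ∀ σ : ℝ, 0 < σ → σ < 2⁻¹ → ∀ Φ : Flows σ, CDAlongAt σ a₀ θ₀ u₀ Φ → ∀ t : ℝ, 0 < t → TailsOn σ a₀ θ₀ u₀ Φ t → FewStepsOn σ a₀ θ₀ u₀ Φ t → PastSmallOn σ a₀ θ₀ u₀ Φ t := by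
  intro a₀ θ₀ u₀ hnice σ hσ hσ2 Φ hCD t ht hT hF γ C φ hγ hγ' hadm δ hδ
  obtain ⟨lam, Cexp, hlam, hTails⟩ := hT
  have hγ3 : γ ≤ 1 / 3 := hγ'.trans (by norm_num)
  have hγ3' : γ < 1 / 3 := hγ'.trans_lt (by norm_num)
  have hC0 : 0 ≤ C := adm_const_nonneg hadm
  set κ := kappa0 C σ with hκ
  have hκ0 : 0 ≤ κ := kappa0_nonneg hC0 hσ
  have hδ4 : 0 < δ / 4 := by positivity
  -- step 1a: the velocity cut-off
  obtain ⟨V, hV1, hVsmall⟩ : ∃ V : ℝ, 1 ≤ V ∧ κ * (13 * cut46 lam V * Cexp) < δ / 4 := by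
    have h : Tendsto (fun V : ℝ => κ * (13 * cut46 lam V * Cexp)) atTop (𝓝 0) := by
      simpa using (((tendsto_cut46 hlam).const_mul 13).mul_const Cexp).const_mul κ
    exact ((eventually_ge_atTop 1).and (h.eventually (gt_mem_nhds hδ4))).exists
  have hV : 0 < V := by linarith
  have hV46 : 0 ≤ V ^ 4 + V ^ 6 := by positivity
  -- step 1b: the few-steps rate
  set c₁ : ℝ := 2 * Real.sqrt 3 * ballVol * C * σ with hc₁
  have hc₁0 : 0 ≤ c₁ := by rw [hc₁]; have := ballVol_nonneg; positivity
  set D : ℝ := κ * (6 * (V ^ 4 + V ^ 6)) * c₁ + 1 with hD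
  have hD0 : 0 < D := by rw [hD]; positivity
  set δ' : ℝ := δ / 4 / D with hδ'
  have hδ'0 : 0 < δ' := by rw [hδ']; positivity
  have hδ'le : κ * (6 * (V ^ 4 + V ^ 6)) * c₁ * δ' ≤ δ / 4 := by
    rw [hδ', mul_div_assoc']
    rw [div_le_iff₀ hD0, hD]
    nlinarith [mul_nonneg (mul_nonneg hκ0 (by positivity : (0:ℝ) ≤ 6 * (V ^ 4 + V ^ 6))) hc₁0]
  have hFew := hF δ' hδ'0
  -- step 1c: large `N`
  have hflight : Tendsto (fun N : ℕ => κ * (6 * (V ^ 4 + V ^ 6)) * (lipK C γ N * Δℓ N) *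
      (Real.sqrt (Cexp / (lam * t)) * t)) atTop (𝓝 0) := by
    simpa using ((tendsto_lipK_mul_lineWindow C hγ3').const_mul (κ * (6 * (V ^ 4 + V ^ 6)))).mul_const
      (Real.sqrt (Cexp / (lam * t)) * t)
  have hev : ∀ᶠ N : ℕ in atTop, (((N : ℝ) + 1) ^ (-γ) < 1 / 2 ∧
      ((N : ℝ) + 1) ^ (-γ) + hsDiameter σ N / 2 < 1 / 2) ∧
      κ * (6 * (V ^ 4 + V ^ 6)) * (lipK C γ N * Δℓ N) * (Real.sqrt (Cexp / (lam * t)) * t) < δ / 4 :=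
    (eventually_small_radius hγ σ).and (hflight.eventually (gt_mem_nhds hδ4))
  -- the Markov sequence
  set P : (N : ℕ) → Measure (Cfg N) := fun N => localGibbsLaw σ a₀ u₀ θ₀ N (Φ N) with hP
  haveI hPprob : ∀ N, IsProbabilityMeasure (P N) := fun N => isProbabilityMeasure_lg hnice hσ2 N (Φ N)
  set Y : (N : ℕ) → Cfg N → ℝ≥0∞ := fun N z =>
    ∫⁻ s in Icc 0 t, ENNReal.ofReal (cdWinMod σ N (Φ N) (s, z)) with hY
  have hYm : ∀ N, Measurable (Y N) := fun N =>
    (ENNReal.measurable_ofReal.comp (measurable_cdWinMod (FlowDict.regular_hsDiameter hσ.le hσ2 N)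
      (Φ N))).lintegral_prod_left'
  have hYint : ∀ N, ∫⁻ z, Y N z ∂(P N) = ∫⁻ s in Icc 0 t, cdMean σ a₀ θ₀ u₀ Φ N s := by
    intro N
    have hmeas : Measurable (Function.uncurry fun (z : Cfg N) (s : ℝ) =>
        ENNReal.ofReal (cdWinMod σ N (Φ N) (s, z))) :=
      ENNReal.measurable_ofReal.comp ((measurable_cdWinMod (FlowDict.regular_hsDiameter hσ.le hσ2 N)
        (Φ N)).comp measurable_swap)
    exact lintegral_lintegral_swap hmeas.aemeasurable
  set cV : ℝ≥0∞ := ENNReal.ofReal (κ * (V ^ 4 + V ^ 6)) with hcV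
  have hMarkov : ∀ N, P N {z | ENNReal.ofReal (δ / 4) ≤ cV * Y N z} ≤
      cV * (∫⁻ s in Icc 0 t, cdMean σ a₀ θ₀ u₀ Φ N s) / ENNReal.ofReal (δ / 4) := by
    intro N
    have h := meas_ge_le_lintegral_div ((hYm N).const_mul cV).aemeasurable
      (ENNReal.ofReal_pos.2 hδ4).ne' ENNReal.ofReal_ne_top (μ := P N)
    rwa [lintegral_const_mul _ (hYm N), hYint N] at h
  have hMarkov0 : Tendsto (fun N => cV * (∫⁻ s in Icc 0 t, cdMean σ a₀ θ₀ u₀ Φ N s) /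
      ENNReal.ofReal (δ / 4)) atTop (𝓝 0) := by
    have h1 := ENNReal.Tendsto.const_mul (tendsto_lintegral_cdMean hσ hσ2 hnice hCD t)
      (Or.inr ENNReal.ofReal_ne_top) (a := cV)
    rw [mul_zero] at h1
    have h2 := ENNReal.Tendsto.div_const h1 (Or.inr (ENNReal.ofReal_pos.2 hδ4).ne')
      (b := ENNReal.ofReal (δ / 4))
    rwa [ENNReal.zero_div] at h2
  -- step 2: the inclusion, for large `N`
  have hincl : ∀ᶠ N : ℕ in atTop, {z : Cfg N | δ < ∫ s in Icc 0 t, ∫ x, PastSq σ N (Φ N) φ s z x} ⊆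
      (((Φ N).goodᶜ ∪ {z | Cexp < ∫ s in Icc 0 t, ∫ y, Real.exp (lam * ‖y.2‖ ^ 2)
          ∂(empiricalMeasure ((Φ N).flow s z))}) ∪
        {z | ENNReal.ofReal (δ' * ((N + 1 : ℕ) : ℝ) ^ ((19 : ℝ) / 15)) <
          ∫⁻ s in Icc 0 t, (steps σ N (winStart σ N (Φ N) s z) (winLen N s) : ℝ≥0∞)}) ∪
        {z | ENNReal.ofReal (δ / 4) ≤ cV * Y N z} := by
    filter_upwards [hev] with N hN
    obtain ⟨⟨hN1, hN2⟩, hN3⟩ := hN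
    intro z hzE
    by_contra hnot
    simp only [mem_union, mem_compl_iff, mem_setOf_eq, not_or, not_not, not_lt, not_le] at hnot
    obtain ⟨⟨⟨hzg, hzT⟩, hzF⟩, hzM⟩ := hnot
    -- the two per-horizon constraints in real form
    rw [tails_integral_eq] at hzT
    have hB0 : 0 ≤ δ' * ((N + 1 : ℕ) : ℝ) ^ ((19 : ℝ) / 15) := by positivity
    have hzF' := integral_steps_le_of_lintegral_le (FlowDict.regular_hsDiameter hσ.le hσ2 N) (Φ N) hzg hB0 hzF
    -- the horizon bound
    have hhb := horizon_bound hσ hσ2 (Φ N) hadm hγ3 hN1 hN2 hzg ht hV hlam hzT hzF'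
    -- the four terms
    set Xcd := ∫ s in Icc 0 t, cdSum σ N (winStart σ N (Φ N) s z) (winLen N s) with hXcd
    have hXcd0 : 0 ≤ Xcd := setIntegral_nonneg measurableSet_Icc fun s _ => (cdSum_mem σ N _ _).1
    have hterm1 : κ * ((V ^ 4 + V ^ 6) * Xcd) < δ / 4 := by
      have hY : cV * Y N z = ENNReal.ofReal (κ * ((V ^ 4 + V ^ 6) * Xcd)) := by
        rw [hcV, hY]
        simp only
        rw [← ofReal_integral_cdSum_eq hσ hσ2 (Φ N) hzg t, ← ENNReal.ofReal_mul (mul_nonneg hκ0 hV46),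
          mul_assoc]
      rw [hY, ENNReal.ofReal_lt_ofReal_iff hδ4] at hzM
      exact hzM
    have hterm3 : κ * (6 * (V ^ 4 + V ^ 6) * (lipK C γ N * hsDiameter σ N / ((N + 1 : ℕ) : ℝ)) *
        (δ' * ((N + 1 : ℕ) : ℝ) ^ ((19 : ℝ) / 15))) ≤ δ / 4 := by
      have hN : (0 : ℝ) < ((N + 1 : ℕ) : ℝ) := by positivity
      have hh := lipK_mul_hsDiameter_mul_le hC0 hσ.le hγ' N (γ := γ)
      have hratio : lipK C γ N * hsDiameter σ N / ((N + 1 : ℕ) : ℝ) * ((N + 1 : ℕ) : ℝ) ^ ((19 : ℝ) / 15) ≤ c₁ := by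
        rw [div_mul_eq_mul_div, div_le_iff₀ hN, hc₁]
        exact hh
      calc κ * (6 * (V ^ 4 + V ^ 6) * (lipK C γ N * hsDiameter σ N / ((N + 1 : ℕ) : ℝ)) *
            (δ' * ((N + 1 : ℕ) : ℝ) ^ ((19 : ℝ) / 15)))
          = κ * (6 * (V ^ 4 + V ^ 6)) * (lipK C γ N * hsDiameter σ N / ((N + 1 : ℕ) : ℝ) *
              ((N + 1 : ℕ) : ℝ) ^ ((19 : ℝ) / 15)) * δ' := by ring
        _ ≤ κ * (6 * (V ^ 4 + V ^ 6)) * c₁ * δ' :=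
            mul_le_mul_of_nonneg_right (mul_le_mul_of_nonneg_left hratio (by positivity)) hδ'0.le
        _ ≤ δ / 4 := hδ'le
    have hterm2 : κ * (6 * (V ^ 4 + V ^ 6) * (lipK C γ N * Δℓ N) * (Real.sqrt (Cexp / (lam * t)) * t)) < δ / 4 := by
      have : κ * (6 * (V ^ 4 + V ^ 6) * (lipK C γ N * Δℓ N) * (Real.sqrt (Cexp / (lam * t)) * t)) =
          κ * (6 * (V ^ 4 + V ^ 6)) * (lipK C γ N * Δℓ N) * (Real.sqrt (Cexp / (lam * t)) * t) := by ring
      rw [this]; exact hN3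
    have hterm4 : κ * (13 * cut46 lam V * Cexp) < δ / 4 := hVsmall
    have hsum : ∫ s in Icc 0 t, ∫ x, PastSq σ N (Φ N) φ s z x < δ := by
      have hexp : κ * ((V ^ 4 + V ^ 6) * Xcd +
          6 * (V ^ 4 + V ^ 6) * (lipK C γ N * Δℓ N) * (Real.sqrt (Cexp / (lam * t)) * t) +
          6 * (V ^ 4 + V ^ 6) * (lipK C γ N * hsDiameter σ N / ((N + 1 : ℕ) : ℝ)) *
            (δ' * ((N + 1 : ℕ) : ℝ) ^ ((19 : ℝ) / 15)) +
          13 * cut46 lam V * Cexp) =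
          κ * ((V ^ 4 + V ^ 6) * Xcd) +
            κ * (6 * (V ^ 4 + V ^ 6) * (lipK C γ N * Δℓ N) * (Real.sqrt (Cexp / (lam * t)) * t)) +
            κ * (6 * (V ^ 4 + V ^ 6) * (lipK C γ N * hsDiameter σ N / ((N + 1 : ℕ) : ℝ)) *
              (δ' * ((N + 1 : ℕ) : ℝ) ^ ((19 : ℝ) / 15))) +
            κ * (13 * cut46 lam V * Cexp) := by ring
      linarith [hhb, hexp.le, hexp.ge]
    exact (lt_irrefl _) (hsum.trans hzE)
  -- step 3: measures
  have hgood0 : ∀ N, P N (Φ N).goodᶜ = 0 := fun N =>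
    (localGibbsLaw_absolutelyContinuous σ a₀ u₀ θ₀ N (Φ N)) (Φ N).measure_compl_good
  have hupper : ∀ᶠ N : ℕ in atTop, P N {z : Cfg N | δ < ∫ s in Icc 0 t, ∫ x, PastSq σ N (Φ N) φ s z x} ≤
      P N {z | Cexp < ∫ s in Icc 0 t, ∫ y, Real.exp (lam * ‖y.2‖ ^ 2) ∂(empiricalMeasure ((Φ N).flow s z))} +
        P N {z | ENNReal.ofReal (δ' * ((N + 1 : ℕ) : ℝ) ^ ((19 : ℝ) / 15)) <
          ∫⁻ s in Icc 0 t, (steps σ N (winStart σ N (Φ N) s z) (winLen N s) : ℝ≥0∞)} +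
        cV * (∫⁻ s in Icc 0 t, cdMean σ a₀ θ₀ u₀ Φ N s) / ENNReal.ofReal (δ / 4) := by
    filter_upwards [hincl] with N hN
    calc P N {z : Cfg N | δ < ∫ s in Icc 0 t, ∫ x, PastSq σ N (Φ N) φ s z x}
        ≤ P N ((((Φ N).goodᶜ ∪ {z | Cexp < ∫ s in Icc 0 t, ∫ y, Real.exp (lam * ‖y.2‖ ^ 2)
            ∂(empiricalMeasure ((Φ N).flow s z))}) ∪
          {z | ENNReal.ofReal (δ' * ((N + 1 : ℕ) : ℝ) ^ ((19 : ℝ) / 15)) <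
            ∫⁻ s in Icc 0 t, (steps σ N (winStart σ N (Φ N) s z) (winLen N s) : ℝ≥0∞)}) ∪
          {z | ENNReal.ofReal (δ / 4) ≤ cV * Y N z}) := measure_mono hN
      _ ≤ P N (Φ N).goodᶜ + P N {z | Cexp < ∫ s in Icc 0 t, ∫ y, Real.exp (lam * ‖y.2‖ ^ 2)
            ∂(empiricalMeasure ((Φ N).flow s z))} +
          P N {z | ENNReal.ofReal (δ' * ((N + 1 : ℕ) : ℝ) ^ ((19 : ℝ) / 15)) <
            ∫⁻ s in Icc 0 t, (steps σ N (winStart σ N (Φ N) s z) (winLen N s) : ℝ≥0∞)} +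
          P N {z | ENNReal.ofReal (δ / 4) ≤ cV * Y N z} :=
          (measure_union_le _ _).trans (add_le_add ((measure_union_le _ _).trans
            (add_le_add (measure_union_le _ _) le_rfl)) le_rfl)
      _ ≤ _ := by
          rw [hgood0 N, zero_add]
          exact add_le_add le_rfl (hMarkov N)
  have hlim : Tendsto (fun N : ℕ =>
      P N {z | Cexp < ∫ s in Icc 0 t, ∫ y, Real.exp (lam * ‖y.2‖ ^ 2) ∂(empiricalMeasure ((Φ N).flow s z))} +
        P N {z | ENNReal.ofReal (δ' * ((N + 1 : ℕ) : ℝ) ^ ((19 : ℝ) / 15)) <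
          ∫⁻ s in Icc 0 t, (steps σ N (winStart σ N (Φ N) s z) (winLen N s) : ℝ≥0∞)} +
        cV * (∫⁻ s in Icc 0 t, cdMean σ a₀ θ₀ u₀ Φ N s) / ENNReal.ofReal (δ / 4)) atTop (𝓝 0) := by
    simpa using (hTails.add hFew).add hMarkov0
  exact tendsto_of_tendsto_of_tendsto_of_le_of_le' tendsto_const_nhds hlim
    (Eventually.of_forall fun N => zero_le) hupper

end

end PastDamping
end Summit.AtomisticToContinuum.HydrodynamicLimit.Theorems.ContactSourceDuhamel.TimeLocal
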